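import Summits.QuantumFields.BalabanUV.T4Continuum.Support.B13AssemblyCoresEndRestrictRecord
import Summits.QuantumFields.BalabanUV.T4Continuum.Support.B13StepOfRecordSubstrate

/-!
# B13AssemblyCoresEndSubstrate — row O1-d2-ii «act instance», follower: THE (2.14)-FACTOR-CORE END OF RECORD AT THE SUBSTRATE's SLOTS OF
# RECORD **ON THE MEASURABLE OPERATOR CARRIER OF RECORD `measOp`**, the sub-slot MEMBERSHIP side conditions `hMA ∕ hMB` and the L01 reading `hT`
# REPLACED BY LETTER CONDITIONS BY NAME (cell `pub-balaban`, T⁴ fan-out, `HOME/BINDER-OWNERS.md` row NE5; unit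
# `b2b-balaban-t4-ne5-formalise-leaf-08`, gen 6; a follower of this lineage's p221018 consuming leaf-01's p221190)

HONEST FRAMING (T4-DAG PAGE 1).  Rung (B)+1 on ONE finite four-torus of fixed physical size — NOT infinite volume, NOT a mass gap, NOT
the Clay problem; `FlowStep.BetaPertH`, (B), (B^μ) do not occur here.  NE5 (`T4OutputRate.NE5`) is NOT PRINTED and NOT PROVED (spine
0/9, unchanged): the END below is an IMPLICATION from displayed binders — «NE5 ⇐ the instance» (trigger c5), NOT «NE5 proved».  The O1
INSTANCE is the SUBSTRATE cell's (Q-NE9-O1, DESIGN RULE R34); this file APPLIES landed faces BY NAME at it (CLAIM RULE 3: not re-wiring) and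
asserts NOTHING about the substrate's letters: which tables `base ∕ rd ∕ coords` realise `C^{(k)}(Z₀,σ)`, `Γ_k` of [Balaban1988RG2Cluster]
(2.14) p. 15, and the smallness making `gaussN ∘ linForm` holomorphic and bounded on the operator balls, stay the substrate's (S-U3).  0 cite
tags; printed KIND only; 0 `def`.  HONEST DEPENDENCY (cell, verbatim): continuum YM on T⁴ ⇐ BetaPertH ∧ nine spine estimates (0/9 proved);
BetaPertH ⇐ (D1) ∧ (D4) ∧ CAP+tail; G-an2-4 gates asym, D1 and NE2/3/4.

WHAT THIS MODULE IS (bookkeeping ∕ [folklore]; two applications BY NAME; no estimate):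
* §1 **`ne5_substrate_cores_actNorm`** — this lineage's record face `B13AssemblyCoresEndRestrictRecord.ne5_slotsOfRecord_cores_actNorm` (p221018
  §2: the (2.14)-factor-core END of record = leaf-04-g3's diamond through `restrict`, at `S₀ := slotsOfRecord …`, `𝔠 := coresRec …`, `hact := rfl`)
  AT THE SUB-SLOT OF RECORD `M := B13OpMeasurable.measOp` (owner R20), with
  - `hMA ∕ hMB` := leaf-01's `B13StepOfRecordSubstrate.opA_mem_measOp_slotsOfRecord ∕ opB_mem_measOp_slotsOfRecord` (p221190 §1) — i.e. REPLACED by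
    the six LETTER conditions `hbdA hmQA hmRA hbdB hmQB hmRB` (format-boundedness of each run's raw record; measurability in the field argument
    `x` of the potential tables `pQ ∕ pR`);
  - `hT` := leaf-01's `transportReads_slotsOfRecord_of_factor` (p221190 §2) — i.e. REPLACED by the factorisation datum `(iopAt, hiopA)` of run A's
    insertion-operator letter through the transport (located interface point F-ne5leaf01g11-1; substrate-p1 ITEM 0 `InsLetters.ofAt` makes
    `hiopA := fun _ _ _ => rfl`);
  - the scalar letters read off `L` (`L.rOp`, `L.rHist`, `L.ins.ω`); EVERY OTHER BINDER of p221018 §2 VERBATIM (the factor letters on the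
    `measOp`-balls about run B's datum of record — by `coresRec_N ∕ _q` the substrate's `gaussN ∕ gaussQ ∘ linForm` clauses —, slice budgets,
    levels L05∕L06 of the instance's outputs, W1 in row NE2's entry currency + floor, W4, rooms, history radius, `A′` ∕ decay split ∕ `Φ′`, sizes);
  conclusion LITERALLY `T4OutputRate.NE5 (B13StepOfRecord.outA (slotsOfRecord …) E₀ cB) (B13StepOfRecord.outB (slotsOfRecord …) E₀ cB) W κ θ′ C₅`,
  the diamond's `C₅` VERBATIM.
* §2 **`exists_ne5_substrate_cores_actNorm`** — the chained face p221018 §3 (arithmetic letters eliminated) the same way ⟹ `∃ C₅, NE5 …`.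
CENSUS vs p221018 §2 ∕ §3 (binders, by name): MINUS = [M, hMA, hMB, hT]; PLUS = [hbdA, hmQA, hmRA, hbdB, hmQB, hmRB, iopAt, hiopA]; rest IDENTICAL
(specialised: `M ↦ measOp …`, `hMB g U k ↦ opB_mem_measOp_slotsOfRecord … g U k`, `(slotsOfRecord …).rOp ∕ .rHist ∕ .D.ω ↦ L.rOp ∕ L.rHist ∕
L.ins.ω` — `rfl`).  The cores-road companion of leaf-01's E8[rec] faces p221190 §3∕§4 at the same instance and carrier.
STATUS (census, Edison rule).  DISPLAYED at the instance on `measOp`: everything listed under «EVERY OTHER BINDER» above.  NOTHING of Bałaban's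
(2.14) data is asserted; 0/12 leaves; NE5 NOT PROVED; spine 0/9; rung (B)+1 finite T⁴; NOT infinite volume ∕ mass gap ∕ Clay.  0 sorry; axioms ⊆
{propext, Classical.choice, Quot.sound}.
-/

noncomputable section

open scoped BigOperators
open Metric MeasureTheory

namespace Summit.QuantumFields.BalabanUV.T4Continuum.B13AssemblyCoresEndSubstrate

open Literature.MathematicalPhysics.QuantumFieldTheory.Balaban1983to89
open Literature.MathematicalPhysics.QuantumFieldTheory.Balaban1983to89.T4OutputRate (DecayBound NE5)
open Literature.MathematicalPhysics.QuantumFieldTheory.Balaban1983to89.B5Prop11Plancherel (Tor)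
open Summit.QuantumFields.BalabanUV.T4Continuum.B13OpDatum (OpDatum FormatBounded)
open Summit.QuantumFields.BalabanUV.T4Continuum.B13OpDatumJunctions (opOf RawBounded WeightedEntrywiseRate)
open Summit.QuantumFields.BalabanUV.T4Continuum.B13OpMeasurable (measOp)
open Summit.QuantumFields.BalabanUV.T4Continuum.B13StepTermLabels (InnerLabel)
open Summit.QuantumFields.BalabanUV.T4Continuum.B13InnerData (Bnd b13InnerData)
open Summit.QuantumFields.BalabanUV.T4Continuum.B13HistMeasurable (MeasPotFrame B13HistM)
open Summit.QuantumFields.BalabanUV.T4Continuum.B13TermCoreFamily (factorCores)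
open Summit.QuantumFields.BalabanUV.T4Continuum.B13TermCoreMass (factorMass)
open Summit.QuantumFields.BalabanUV.T4Continuum.UrsellTreeSum (ind)
open Summit.QuantumFields.BalabanUV.T4Continuum.UrsellTermBudget (actSum)
open Summit.QuantumFields.BalabanUV.T4Continuum.B13DomainGeometryTR (SCube footprint)
open Summit.QuantumFields.BalabanUV.T4Continuum.B13StepOfRecord (assembly step)
open Summit.QuantumFields.BalabanUV.T4Continuum.SubstrateBackgroundTransporters (unitMod)
open Summit.QuantumFields.BalabanUV.T4Continuum.SubstrateTwoRunsDriven (DrivenRuns)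
open Summit.QuantumFields.BalabanUV.T4Continuum.SubstrateRawSpecies (rawAOfRecord rawBOfRecord)
open Summit.QuantumFields.BalabanUV.T4Continuum.SubstrateSlotsOfRecord (SpeciesRec SlotLetters slotsOfRecord)
open Summit.QuantumFields.BalabanUV.T4Continuum.B13AssemblyCoresEndRestrictRecord (coresRec ne5_slotsOfRecord_cores_actNorm
  exists_ne5_slotsOfRecord_cores_actNorm)
open Summit.QuantumFields.BalabanUV.T4Continuum.B13StepOfRecordSubstrate (opA_mem_measOp_slotsOfRecord opB_mem_measOp_slotsOfRecord
  transportReads_slotsOfRecord_of_factor)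

variable {G : Type} [GaugeGroup G] (D : DrivenRuns G)
variable {o : Type} [Fintype o] [DecidableEq o] (ι : G →* Matrix o o ℂ) (c : ℂ) (a : ℝ) (s : ℕ → ℂ)
variable {T ι' S Ω 𝒴 : Type} [MeasurableSpace Ω] (P : MeasPotFrame D.carriers) {IOp : Type*}
  (𝒵 : D.carriers.Dom → InnerLabel D.carriers.Dom (Bnd D.toTwoRuns) → Type) [∀ Z j, Fintype (𝒵 Z j)] (dom : ∀ Z j, 𝒵 Z j → D.carriers.Dom)
  (Jc : D.carriers.Dom → InnerLabel D.carriers.Dom (Bnd D.toTwoRuns) → Type) [∀ Z j, Fintype (Jc Z j)]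
  (V : D.carriers.Dom → InnerLabel D.carriers.Dom (Bnd D.toTwoRuns) → Type) [∀ Z j, NormedAddCommGroup (V Z j)]
  [∀ Z j, InnerProductSpace ℝ (V Z j)] [∀ Z j, MeasurableSpace (V Z j)] [∀ Z j, BorelSpace (V Z j)] [∀ Z j, FiniteDimensional ℝ (V Z j)]
  (mI : D.carriers.Dom → InnerLabel D.carriers.Dom (Bnd D.toTwoRuns) → Type) [∀ Z j, Fintype (mI Z j)] [∀ Z j, DecidableEq (mI Z j)]
  (L : SlotLetters D (o := o) (T := T) (ι' := ι') (S := S) (Ω := Ω) (𝒴 := 𝒴) P (IOp := IOp) 𝒵 dom Jc V mI)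

section Instance

variable
  -- p221190 §1's letter conditions (replace `hMA` ∕ `hMB` at `M := measOp`)
  (hbdA : ∀ (g : ℕ → ℝ) (U : D.carriers.BgA) (k : ℕ),
    FormatBounded (L.W k).format (rawAOfRecord ι D c a s L.ΓA L.dkA L.gcA L.pQA L.pRA g U k).kernel)
  (hmQA : ∀ (r : ℝ) (U : GaugeField (D.F.P D.K) 0 G) (k : ℕ) (Y : 𝒴) (b b' : ((Tor (unitMod (D.F.P D.K)) × Fin (D.F.P D.K).d) × o)),
    Measurable fun x : Ω => L.pQA r U k x Y b b')
  (hmRA : ∀ (r : ℝ) (U : GaugeField (D.F.P D.K) 0 G) (k : ℕ) (Y : 𝒴), Measurable fun x : Ω => L.pRA r U k x Y)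
  (hbdB : ∀ (g : ℕ → ℝ) (U : D.carriers.BgB) (k : ℕ),
    FormatBounded (L.W k).format (rawBOfRecord ι D c a s L.ΓB L.dkB L.gcB L.pQB L.pRB g U k).kernel)
  (hmQB : ∀ (r : ℝ) (U : GaugeField (D.F.P (D.K + 1)) 0 G) (k : ℕ) (Y : 𝒴) (b b' : ((Tor (unitMod (D.F.P D.K)) × Fin (D.F.P D.K).d) × o)),
    Measurable fun x : Ω => L.pQB r U k x Y b b')
  (hmRB : ∀ (r : ℝ) (U : GaugeField (D.F.P (D.K + 1)) 0 G) (k : ℕ) (Y : 𝒴), Measurable fun x : Ω => L.pRB r U k x Y)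
  -- p221190 §2's factorisation datum (replaces `hT`)
  (iopAt : ℝ → D.carriers.BgA → ℕ → IOp)
  (hiopA : ∀ (r : ℝ) (U : D.carriers.BgB) (k : ℕ), L.ins.iopA r U k = iopAt r (D.carriers.transport U) k)
  (E₀ cB : ℝ)

/-! ## §1 The (2.14)-factor-core END of record at the substrate's slots of record on `measOp` -/

include hbdA hmQA hmRA hiopA in
/-- [folklore] **THE (2.14)-FACTOR-CORE END OF RECORD AT THE SUBSTRATE's SLOTS OF RECORD ON THE MEASURABLE OPERATOR CARRIER** —
`B13AssemblyCoresEndRestrictRecord.ne5_slotsOfRecord_cores_actNorm` (p221018 §2) at `M := measOp …`, `hMA ∕ hMB :=` p221190 §1's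
`opA_mem_measOp_slotsOfRecord ∕ opB_mem_measOp_slotsOfRecord` (six LETTER conditions), `hT :=` p221190 §2's `transportReads_slotsOfRecord_of_factor`
(factorisation datum `(iopAt, hiopA)`).  Binders (all DISPLAYED, in p221018's order): the slice budgets, the levels of the instance's outputs, W1 in
row NE2's entry currency + floor, W4, rooms, the factor letters on the `measOp`-balls about run B's datum of record (= the substrate's `gaussN ∕ gaussQ
∘ linForm` clauses by `coresRec_N ∕ _q`), the history radius, `A′` ∕ decay split ∕ `Φ′`, sizes.  Conclusion LITERALLY `T4OutputRate.NE5
(B13StepOfRecord.outA (slotsOfRecord …) E₀ cB) (B13StepOfRecord.outB (slotsOfRecord …) E₀ cB) W κ θ′ C₅`, the diamond's `C₅`.  «NE5 ⇐ the instance» —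
NOT NE5 proved; no letter of the substrate asserted. -/
theorem ne5_substrate_cores_actNorm {W : Set (ℕ → ℝ)} {ROp RHist R' H : ℕ → ℝ}
    {N₀f mf bf : D.carriers.Dom → InnerLabel D.carriers.Dom (Bnd D.toTwoRuns) → ℝ}
    {A' : ℕ → D.carriers.Dom → InnerLabel D.carriers.Dom (Bnd D.toTwoRuns) → ℝ}
    {mstar κ Φ' EA₀ E₁ cA c₁ r₀ δ' θ θ' ρ₀ B : ℝ} {k₀ : ℕ}
    (hbB : (assembly (slotsOfRecord D ι c a s P 𝒵 dom Jc V mI L)).SliceBudgetB W κ cB)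
    (hbA : (slotsOfRecord D ι c a s P 𝒵 dom Jc V mI L).D.SliceBudget (step (slotsOfRecord D ι c a s P 𝒵 dom Jc V mI L) E₀ cB) W κ cA)
    (hdA : DecayBound (B13StepOfRecord.outA (slotsOfRecord D ι c a s P 𝒵 dom Jc V mI L) E₀ cB) W EA₀ κ)
    (hdB : DecayBound (B13StepOfRecord.outB (slotsOfRecord D ι c a s P 𝒵 dom Jc V mI L) E₀ cB) W E₀ κ)
    (hRA : RawBounded (slotsOfRecord D ι c a s P 𝒵 dom Jc V mI L).F (assembly (slotsOfRecord D ι c a s P 𝒵 dom Jc V mI L)).rawAt W)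
    (hRB : RawBounded (slotsOfRecord D ι c a s P 𝒵 dom Jc V mI L).F (slotsOfRecord D ι c a s P 𝒵 dom Jc V mI L).rawB W)
    (hwer : WeightedEntrywiseRate (slotsOfRecord D ι c a s P 𝒵 dom Jc V mI L).F (assembly (slotsOfRecord D ι c a s P 𝒵 dom Jc V mI L)).rawAt
      (slotsOfRecord D ι c a s P 𝒵 dom Jc V mI L).rawB W c₁ fun k => θ ^ k)
    (hfl : ∀ k, r₀ ≤ L.rOp k)
    (hins : (step (slotsOfRecord D ι c a s P 𝒵 dom Jc V mI L) E₀ cB).InsertionRate W κ E₀ δ' θ)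
    (hOp : ∀ k, L.rOp k ≤ ROp k) (hroom : ∀ k, ROp k < R' k)
    (hHist : ∀ k, (assembly (slotsOfRecord D ι c a s P 𝒵 dom Jc V mI L)).bHist E₀ cB k + L.rHist k ≤ RHist k)
    -- the factor letters in the substrate's currency, on the `measOp`-balls
    (hm : 0 < mstar) (hmf : ∀ Z ℓ, mstar ≤ mf Z ℓ) (hN₀ : ∀ Z ℓ, 0 ≤ N₀f Z ℓ)
    (hNf : ∀ k, ∀ g ∈ W, ∀ (U : D.carriers.BgB) (X : D.carriers.Dom), D.carriers.scale X = k →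
      ∀ i, (assembly (slotsOfRecord D ι c a s P 𝒵 dom Jc V mI L)).𝒯.Rel k i X →
      ∀ m : Fin ((assembly (slotsOfRecord D ι c a s P 𝒵 dom Jc V mI L)).𝒯.len i + 1),
      (∀ op ∈ ball (⟨opOf (slotsOfRecord D ι c a s P 𝒵 dom Jc V mI L).F (slotsOfRecord D ι c a s P 𝒵 dom Jc V mI L).rawB g U k,
          opB_mem_measOp_slotsOfRecord D ι c a s P 𝒵 dom Jc V mI L hbdB hmQB hmRB g U k⟩ :
            measOp T ((Tor (unitMod (D.F.P D.K)) × Fin (D.F.P D.K).d) × o) ι' Ω 𝒴) (R' k),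
        AEStronglyMeasurable ((factorCores (assembly (slotsOfRecord D ι c a s P 𝒵 dom Jc V mI L)).𝒯 (coresRec D P 𝒵 dom Jc V mI L) i m).N
          (op : OpDatum _)) (factorCores (assembly (slotsOfRecord D ι c a s P 𝒵 dom Jc V mI L)).𝒯 (coresRec D P 𝒵 dom Jc V mI L) i m).lam) ∧
      (∀ p, DifferentiableOn ℂ (fun op : measOp T ((Tor (unitMod (D.F.P D.K)) × Fin (D.F.P D.K).d) × o) ι' Ω 𝒴 =>
          (factorCores (assembly (slotsOfRecord D ι c a s P 𝒵 dom Jc V mI L)).𝒯 (coresRec D P 𝒵 dom Jc V mI L) i m).N (op : OpDatum _) p)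
        (ball (⟨opOf (slotsOfRecord D ι c a s P 𝒵 dom Jc V mI L).F (slotsOfRecord D ι c a s P 𝒵 dom Jc V mI L).rawB g U k,
          opB_mem_measOp_slotsOfRecord D ι c a s P 𝒵 dom Jc V mI L hbdB hmQB hmRB g U k⟩ :
            measOp T ((Tor (unitMod (D.F.P D.K)) × Fin (D.F.P D.K).d) × o) ι' Ω 𝒴) (R' k))) ∧
      (∀ op ∈ ball (⟨opOf (slotsOfRecord D ι c a s P 𝒵 dom Jc V mI L).F (slotsOfRecord D ι c a s P 𝒵 dom Jc V mI L).rawB g U k,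
          opB_mem_measOp_slotsOfRecord D ι c a s P 𝒵 dom Jc V mI L hbdB hmQB hmRB g U k⟩ :
            measOp T ((Tor (unitMod (D.F.P D.K)) × Fin (D.F.P D.K).d) × o) ι' Ω 𝒴) (R' k), ∀ p,
        ‖(factorCores (assembly (slotsOfRecord D ι c a s P 𝒵 dom Jc V mI L)).𝒯 (coresRec D P 𝒵 dom Jc V mI L) i m).N (op : OpDatum _) p‖ ≤
          N₀f ((assembly (slotsOfRecord D ι c a s P 𝒵 dom Jc V mI L)).𝒯.poly i m)
            ((assembly (slotsOfRecord D ι c a s P 𝒵 dom Jc V mI L)).𝒯.lab i m)))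
    (hqf : ∀ k, ∀ g ∈ W, ∀ (U : D.carriers.BgB) (X : D.carriers.Dom), D.carriers.scale X = k →
      ∀ i, (assembly (slotsOfRecord D ι c a s P 𝒵 dom Jc V mI L)).𝒯.Rel k i X →
      ∀ m : Fin ((assembly (slotsOfRecord D ι c a s P 𝒵 dom Jc V mI L)).𝒯.len i + 1),
      (∀ op ∈ ball (⟨opOf (slotsOfRecord D ι c a s P 𝒵 dom Jc V mI L).F (slotsOfRecord D ι c a s P 𝒵 dom Jc V mI L).rawB g U k,
          opB_mem_measOp_slotsOfRecord D ι c a s P 𝒵 dom Jc V mI L hbdB hmQB hmRB g U k⟩ :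
            measOp T ((Tor (unitMod (D.F.P D.K)) × Fin (D.F.P D.K).d) × o) ι' Ω 𝒴) (R' k),
        AEStronglyMeasurable (Function.uncurry
          ((factorCores (assembly (slotsOfRecord D ι c a s P 𝒵 dom Jc V mI L)).𝒯 (coresRec D P 𝒵 dom Jc V mI L) i m).q (op : OpDatum _)))
          ((factorCores (assembly (slotsOfRecord D ι c a s P 𝒵 dom Jc V mI L)).𝒯 (coresRec D P 𝒵 dom Jc V mI L) i m).lam.prod volume)) ∧
      (∀ p v, DifferentiableOn ℂ (fun op : measOp T ((Tor (unitMod (D.F.P D.K)) × Fin (D.F.P D.K).d) × o) ι' Ω 𝒴 =>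
          (factorCores (assembly (slotsOfRecord D ι c a s P 𝒵 dom Jc V mI L)).𝒯 (coresRec D P 𝒵 dom Jc V mI L) i m).q (op : OpDatum _) p v)
        (ball (⟨opOf (slotsOfRecord D ι c a s P 𝒵 dom Jc V mI L).F (slotsOfRecord D ι c a s P 𝒵 dom Jc V mI L).rawB g U k,
          opB_mem_measOp_slotsOfRecord D ι c a s P 𝒵 dom Jc V mI L hbdB hmQB hmRB g U k⟩ :
            measOp T ((Tor (unitMod (D.F.P D.K)) × Fin (D.F.P D.K).d) × o) ι' Ω 𝒴) (R' k))) ∧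
      (∀ op ∈ ball (⟨opOf (slotsOfRecord D ι c a s P 𝒵 dom Jc V mI L).F (slotsOfRecord D ι c a s P 𝒵 dom Jc V mI L).rawB g U k,
          opB_mem_measOp_slotsOfRecord D ι c a s P 𝒵 dom Jc V mI L hbdB hmQB hmRB g U k⟩ :
            measOp T ((Tor (unitMod (D.F.P D.K)) × Fin (D.F.P D.K).d) × o) ι' Ω 𝒴) (R' k), ∀ p v,
        mf ((assembly (slotsOfRecord D ι c a s P 𝒵 dom Jc V mI L)).𝒯.poly i m) ((assembly (slotsOfRecord D ι c a s P 𝒵 dom Jc V mI L)).𝒯.lab i m) *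
            ‖v‖ ^ 2 -
          bf ((assembly (slotsOfRecord D ι c a s P 𝒵 dom Jc V mI L)).𝒯.poly i m) ((assembly (slotsOfRecord D ι c a s P 𝒵 dom Jc V mI L)).𝒯.lab i m) ≤
          ((factorCores (assembly (slotsOfRecord D ι c a s P 𝒵 dom Jc V mI L)).𝒯 (coresRec D P 𝒵 dom Jc V mI L) i m).q (op : OpDatum _) p v).re))
    (hH : ∀ k, ∀ g ∈ W, ∀ U : D.carriers.BgB, ‖(assembly (slotsOfRecord D ι c a s P 𝒵 dom Jc V mI L)).histRef g U k‖ + RHist k ≤ H k)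
    -- the stripped majorant's decay split and anchored exponential norm
    (hκ : 0 ≤ κ) (hA0' : ∀ k Z ℓ, 0 ≤ A' k Z ℓ)
    (hdec : ∀ k Z ℓ, factorMass (coresRec D P 𝒵 dom Jc V mI L) N₀f bf mstar (H k) Z ℓ ≤ A' k Z ℓ * Real.exp (-(κ * (D.carriers.d Z + 5))))
    (hΦ0 : 0 ≤ Φ') (hsmallΦ : 36 * Φ' < 1)
    (hΦ : ∀ (k : ℕ) (q : SCube D.toTwoRuns), ∑ Z ∈ D.toTwoRuns.domAt k,
      ind (q ∈ footprint Z) * actSum (b13InnerData D.toTwoRuns) (A' k) k Z * Real.exp ((footprint Z).card) ≤ Φ')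
    (hE₀ : 0 ≤ E₀) (hE₁ : 0 < E₁) (hcA : 0 ≤ cA) (hcB : 0 ≤ cB) (hc₁ : 0 ≤ c₁) (hr₀ : 0 < r₀) (hδ' : 0 ≤ δ')
    (hθ : 0 ≤ θ) (hθθ' : θ ≤ θ') (hθ'1 : θ' ≤ 1) (hω : 0 < L.ins.ω) (hω1 : L.ins.ω < 1) (hρ₀ : ρ₀ < 1)
    (hnear : (c₁ / r₀ + δ') * θ ^ k₀ + cA * (EA₀ + E₀) / (1 - L.ins.ω) ≤ ρ₀) (hB : 0 ≤ B)
    (hfirst : ∀ k < k₀, EA₀ + E₀ ≤ B * θ ^ k)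
    (hsmall : L.ins.ω + Φ' / (1 - 36 * Φ') / (1 - ρ₀) * cA < θ') :
    NE5 (B13StepOfRecord.outA (slotsOfRecord D ι c a s P 𝒵 dom Jc V mI L) E₀ cB)
      (B13StepOfRecord.outB (slotsOfRecord D ι c a s P 𝒵 dom Jc V mI L) E₀ cB) W κ θ'
      ((Φ' / (1 - 36 * Φ') / (1 - ρ₀) * (c₁ / r₀) + Φ' / (1 - 36 * Φ') / (1 - ρ₀) * δ' + B) * (θ' - L.ins.ω) /
        (θ' - (L.ins.ω + Φ' / (1 - 36 * Φ') / (1 - ρ₀) * cA))) :=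
  ne5_slotsOfRecord_cores_actNorm D ι c a s P 𝒵 dom Jc V mI L
    (measOp T ((Tor (unitMod (D.F.P D.K)) × Fin (D.F.P D.K).d) × o) ι' Ω 𝒴)
    (opA_mem_measOp_slotsOfRecord D ι c a s P 𝒵 dom Jc V mI L hbdA hmQA hmRA)
    (opB_mem_measOp_slotsOfRecord D ι c a s P 𝒵 dom Jc V mI L hbdB hmQB hmRB) E₀ cB
    (transportReads_slotsOfRecord_of_factor D ι c a s P 𝒵 dom Jc V mI L iopAt hiopA W) hbB hbA hdA hdB hRA hRB hwer hfl hins hOp hroom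
    hHist hm hmf hN₀ hNf hqf hH hκ hA0' hdec hΦ0 hsmallΦ hΦ hE₀ hE₁ hcA hcB hc₁ hr₀ hδ' hθ hθθ' hθ'1 hω hω1 hρ₀ hnear hB hfirst hsmall

/-! ## §2 The chained face at the substrate's slots of record on `measOp` -/

include hbdA hmQA hmRA hiopA in
/-- [folklore] **THE CHAINED (2.14)-FACTOR-CORE END OF RECORD AT THE SUBSTRATE's SLOTS OF RECORD ON `measOp`** —
`B13AssemblyCoresEndRestrictRecord.exists_ne5_slotsOfRecord_cores_actNorm` (p221018 §3: arithmetic letters eliminated — `0 < θ < 1`,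
`cA(EA₀ + E₀) < 1 − ω`, `ω + (Φ′∕(1 − 36Φ′))·cA·(1 − ω)∕(1 − ω − cA(EA₀ + E₀)) < θ′`) at `M := measOp …`, `hMA ∕ hMB ∕ hT` replaced by p221190's
letter conditions and factorisation datum ⟹ `∃ C₅, NE5 (B13StepOfRecord.outA (slotsOfRecord …) E₀ cB) (B13StepOfRecord.outB (slotsOfRecord …) E₀ cB)
W κ θ′ C₅`.  «NE5 ⇐ the instance». -/
theorem exists_ne5_substrate_cores_actNorm {W : Set (ℕ → ℝ)} {ROp RHist R' H : ℕ → ℝ}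
    {N₀f mf bf : D.carriers.Dom → InnerLabel D.carriers.Dom (Bnd D.toTwoRuns) → ℝ}
    {A' : ℕ → D.carriers.Dom → InnerLabel D.carriers.Dom (Bnd D.toTwoRuns) → ℝ}
    {mstar κ Φ' EA₀ cA c₁ r₀ δ' θ θ' : ℝ}
    (hbB : (assembly (slotsOfRecord D ι c a s P 𝒵 dom Jc V mI L)).SliceBudgetB W κ cB)
    (hbA : (slotsOfRecord D ι c a s P 𝒵 dom Jc V mI L).D.SliceBudget (step (slotsOfRecord D ι c a s P 𝒵 dom Jc V mI L) E₀ cB) W κ cA)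
    (hdA : DecayBound (B13StepOfRecord.outA (slotsOfRecord D ι c a s P 𝒵 dom Jc V mI L) E₀ cB) W EA₀ κ)
    (hdB : DecayBound (B13StepOfRecord.outB (slotsOfRecord D ι c a s P 𝒵 dom Jc V mI L) E₀ cB) W E₀ κ)
    (hRA : RawBounded (slotsOfRecord D ι c a s P 𝒵 dom Jc V mI L).F (assembly (slotsOfRecord D ι c a s P 𝒵 dom Jc V mI L)).rawAt W)
    (hRB : RawBounded (slotsOfRecord D ι c a s P 𝒵 dom Jc V mI L).F (slotsOfRecord D ι c a s P 𝒵 dom Jc V mI L).rawB W)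
    (hwer : WeightedEntrywiseRate (slotsOfRecord D ι c a s P 𝒵 dom Jc V mI L).F (assembly (slotsOfRecord D ι c a s P 𝒵 dom Jc V mI L)).rawAt
      (slotsOfRecord D ι c a s P 𝒵 dom Jc V mI L).rawB W c₁ fun k => θ ^ k)
    (hfl : ∀ k, r₀ ≤ L.rOp k)
    (hins : (step (slotsOfRecord D ι c a s P 𝒵 dom Jc V mI L) E₀ cB).InsertionRate W κ E₀ δ' θ)
    (hOp : ∀ k, L.rOp k ≤ ROp k) (hroom : ∀ k, ROp k < R' k)
    (hHist : ∀ k, (assembly (slotsOfRecord D ι c a s P 𝒵 dom Jc V mI L)).bHist E₀ cB k + L.rHist k ≤ RHist k)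
    (hm : 0 < mstar) (hmf : ∀ Z ℓ, mstar ≤ mf Z ℓ) (hN₀ : ∀ Z ℓ, 0 ≤ N₀f Z ℓ)
    (hNf : ∀ k, ∀ g ∈ W, ∀ (U : D.carriers.BgB) (X : D.carriers.Dom), D.carriers.scale X = k →
      ∀ i, (assembly (slotsOfRecord D ι c a s P 𝒵 dom Jc V mI L)).𝒯.Rel k i X →
      ∀ m : Fin ((assembly (slotsOfRecord D ι c a s P 𝒵 dom Jc V mI L)).𝒯.len i + 1),
      (∀ op ∈ ball (⟨opOf (slotsOfRecord D ι c a s P 𝒵 dom Jc V mI L).F (slotsOfRecord D ι c a s P 𝒵 dom Jc V mI L).rawB g U k,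
          opB_mem_measOp_slotsOfRecord D ι c a s P 𝒵 dom Jc V mI L hbdB hmQB hmRB g U k⟩ :
            measOp T ((Tor (unitMod (D.F.P D.K)) × Fin (D.F.P D.K).d) × o) ι' Ω 𝒴) (R' k),
        AEStronglyMeasurable ((factorCores (assembly (slotsOfRecord D ι c a s P 𝒵 dom Jc V mI L)).𝒯 (coresRec D P 𝒵 dom Jc V mI L) i m).N
          (op : OpDatum _)) (factorCores (assembly (slotsOfRecord D ι c a s P 𝒵 dom Jc V mI L)).𝒯 (coresRec D P 𝒵 dom Jc V mI L) i m).lam) ∧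
      (∀ p, DifferentiableOn ℂ (fun op : measOp T ((Tor (unitMod (D.F.P D.K)) × Fin (D.F.P D.K).d) × o) ι' Ω 𝒴 =>
          (factorCores (assembly (slotsOfRecord D ι c a s P 𝒵 dom Jc V mI L)).𝒯 (coresRec D P 𝒵 dom Jc V mI L) i m).N (op : OpDatum _) p)
        (ball (⟨opOf (slotsOfRecord D ι c a s P 𝒵 dom Jc V mI L).F (slotsOfRecord D ι c a s P 𝒵 dom Jc V mI L).rawB g U k,
          opB_mem_measOp_slotsOfRecord D ι c a s P 𝒵 dom Jc V mI L hbdB hmQB hmRB g U k⟩ :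
            measOp T ((Tor (unitMod (D.F.P D.K)) × Fin (D.F.P D.K).d) × o) ι' Ω 𝒴) (R' k))) ∧
      (∀ op ∈ ball (⟨opOf (slotsOfRecord D ι c a s P 𝒵 dom Jc V mI L).F (slotsOfRecord D ι c a s P 𝒵 dom Jc V mI L).rawB g U k,
          opB_mem_measOp_slotsOfRecord D ι c a s P 𝒵 dom Jc V mI L hbdB hmQB hmRB g U k⟩ :
            measOp T ((Tor (unitMod (D.F.P D.K)) × Fin (D.F.P D.K).d) × o) ι' Ω 𝒴) (R' k), ∀ p,
        ‖(factorCores (assembly (slotsOfRecord D ι c a s P 𝒵 dom Jc V mI L)).𝒯 (coresRec D P 𝒵 dom Jc V mI L) i m).N (op : OpDatum _) p‖ ≤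
          N₀f ((assembly (slotsOfRecord D ι c a s P 𝒵 dom Jc V mI L)).𝒯.poly i m)
            ((assembly (slotsOfRecord D ι c a s P 𝒵 dom Jc V mI L)).𝒯.lab i m)))
    (hqf : ∀ k, ∀ g ∈ W, ∀ (U : D.carriers.BgB) (X : D.carriers.Dom), D.carriers.scale X = k →
      ∀ i, (assembly (slotsOfRecord D ι c a s P 𝒵 dom Jc V mI L)).𝒯.Rel k i X →
      ∀ m : Fin ((assembly (slotsOfRecord D ι c a s P 𝒵 dom Jc V mI L)).𝒯.len i + 1),
      (∀ op ∈ ball (⟨opOf (slotsOfRecord D ι c a s P 𝒵 dom Jc V mI L).F (slotsOfRecord D ι c a s P 𝒵 dom Jc V mI L).rawB g U k,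
          opB_mem_measOp_slotsOfRecord D ι c a s P 𝒵 dom Jc V mI L hbdB hmQB hmRB g U k⟩ :
            measOp T ((Tor (unitMod (D.F.P D.K)) × Fin (D.F.P D.K).d) × o) ι' Ω 𝒴) (R' k),
        AEStronglyMeasurable (Function.uncurry
          ((factorCores (assembly (slotsOfRecord D ι c a s P 𝒵 dom Jc V mI L)).𝒯 (coresRec D P 𝒵 dom Jc V mI L) i m).q (op : OpDatum _)))
          ((factorCores (assembly (slotsOfRecord D ι c a s P 𝒵 dom Jc V mI L)).𝒯 (coresRec D P 𝒵 dom Jc V mI L) i m).lam.prod volume)) ∧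
      (∀ p v, DifferentiableOn ℂ (fun op : measOp T ((Tor (unitMod (D.F.P D.K)) × Fin (D.F.P D.K).d) × o) ι' Ω 𝒴 =>
          (factorCores (assembly (slotsOfRecord D ι c a s P 𝒵 dom Jc V mI L)).𝒯 (coresRec D P 𝒵 dom Jc V mI L) i m).q (op : OpDatum _) p v)
        (ball (⟨opOf (slotsOfRecord D ι c a s P 𝒵 dom Jc V mI L).F (slotsOfRecord D ι c a s P 𝒵 dom Jc V mI L).rawB g U k,
          opB_mem_measOp_slotsOfRecord D ι c a s P 𝒵 dom Jc V mI L hbdB hmQB hmRB g U k⟩ :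
            measOp T ((Tor (unitMod (D.F.P D.K)) × Fin (D.F.P D.K).d) × o) ι' Ω 𝒴) (R' k))) ∧
      (∀ op ∈ ball (⟨opOf (slotsOfRecord D ι c a s P 𝒵 dom Jc V mI L).F (slotsOfRecord D ι c a s P 𝒵 dom Jc V mI L).rawB g U k,
          opB_mem_measOp_slotsOfRecord D ι c a s P 𝒵 dom Jc V mI L hbdB hmQB hmRB g U k⟩ :
            measOp T ((Tor (unitMod (D.F.P D.K)) × Fin (D.F.P D.K).d) × o) ι' Ω 𝒴) (R' k), ∀ p v,
        mf ((assembly (slotsOfRecord D ι c a s P 𝒵 dom Jc V mI L)).𝒯.poly i m) ((assembly (slotsOfRecord D ι c a s P 𝒵 dom Jc V mI L)).𝒯.lab i m) *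
            ‖v‖ ^ 2 -
          bf ((assembly (slotsOfRecord D ι c a s P 𝒵 dom Jc V mI L)).𝒯.poly i m) ((assembly (slotsOfRecord D ι c a s P 𝒵 dom Jc V mI L)).𝒯.lab i m) ≤
          ((factorCores (assembly (slotsOfRecord D ι c a s P 𝒵 dom Jc V mI L)).𝒯 (coresRec D P 𝒵 dom Jc V mI L) i m).q (op : OpDatum _) p v).re))
    (hH : ∀ k, ∀ g ∈ W, ∀ U : D.carriers.BgB, ‖(assembly (slotsOfRecord D ι c a s P 𝒵 dom Jc V mI L)).histRef g U k‖ + RHist k ≤ H k)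
    (hκ : 0 ≤ κ) (hA0' : ∀ k Z ℓ, 0 ≤ A' k Z ℓ)
    (hdec : ∀ k Z ℓ, factorMass (coresRec D P 𝒵 dom Jc V mI L) N₀f bf mstar (H k) Z ℓ ≤ A' k Z ℓ * Real.exp (-(κ * (D.carriers.d Z + 5))))
    (hΦ0 : 0 ≤ Φ') (hsmallΦ : 36 * Φ' < 1)
    (hΦ : ∀ (k : ℕ) (q : SCube D.toTwoRuns), ∑ Z ∈ D.toTwoRuns.domAt k,
      ind (q ∈ footprint Z) * actSum (b13InnerData D.toTwoRuns) (A' k) k Z * Real.exp ((footprint Z).card) ≤ Φ')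
    (hE₀ : 0 ≤ E₀) (hcA : 0 ≤ cA) (hcB : 0 ≤ cB) (hc₁ : 0 ≤ c₁) (hr₀ : 0 < r₀) (hδ' : 0 ≤ δ')
    (hθ0 : 0 < θ) (hθ1 : θ < 1) (hθθ' : θ ≤ θ') (hθ'1 : θ' ≤ 1) (hω : 0 < L.ins.ω) (hω1 : L.ins.ω < 1)
    (hh : cA * (EA₀ + E₀) < 1 - L.ins.ω)
    (hsmall : L.ins.ω + Φ' / (1 - 36 * Φ') * cA * (1 - L.ins.ω) / (1 - L.ins.ω - cA * (EA₀ + E₀)) < θ') :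
    ∃ C₅, NE5 (B13StepOfRecord.outA (slotsOfRecord D ι c a s P 𝒵 dom Jc V mI L) E₀ cB)
      (B13StepOfRecord.outB (slotsOfRecord D ι c a s P 𝒵 dom Jc V mI L) E₀ cB) W κ θ' C₅ :=
  exists_ne5_slotsOfRecord_cores_actNorm D ι c a s P 𝒵 dom Jc V mI L
    (measOp T ((Tor (unitMod (D.F.P D.K)) × Fin (D.F.P D.K).d) × o) ι' Ω 𝒴)
    (opA_mem_measOp_slotsOfRecord D ι c a s P 𝒵 dom Jc V mI L hbdA hmQA hmRA)
    (opB_mem_measOp_slotsOfRecord D ι c a s P 𝒵 dom Jc V mI L hbdB hmQB hmRB) E₀ cB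
    (transportReads_slotsOfRecord_of_factor D ι c a s P 𝒵 dom Jc V mI L iopAt hiopA W) hbB hbA hdA hdB hRA hRB hwer hfl hins hOp hroom
    hHist hm hmf hN₀ hNf hqf hH hκ hA0' hdec hΦ0 hsmallΦ hΦ hE₀ hcA hcB hc₁ hr₀ hδ' hθ0 hθ1 hθθ' hθ'1 hω hω1 hh hsmall

end Instance

end Summit.QuantumFields.BalabanUV.T4Continuum.B13AssemblyCoresEndSubstrate

end
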